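import Summits.NavierStokesRegularity.FunctionalMining.NoGo.TopBotEigSplitFloor
import HarnessLib

/-!
# FunctionalMining / NoGo — K10b: the second-difference CEILING of `‖·‖^q`, the split density
# `k = f_q − c‖·‖^q`, and convexity from local midpoint second differences (door D-K6 (c))

HONEST FRAMING. Search for candidate a priori estimates; no regularity claim. Nothing about
Navier–Stokes is proved or asserted in this file: finite-dimensional inequalities for flat
`3 × 3` tensors (and, in K10b, two lemmas of one-variable real analysis). Cell `pub-nsfunc`,
no-go seat (gen 38), kernel candidate K10 = three files K10a `NoGo/TopBotEigSplitFloor`,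
K10b `NoGo/TopBotEigSplitCeiling`, K10c `NoGo/TopBotEigSplitting` (this order of imports).

THE TARGET. The staged K9 `NoGo/TopBotEigHeatCoerciveSplit` reduced the door-(c) node
`TopBotEigHeatCoercivePos q` (real `q > 2`: heat coercivity of the symmetrised core `Φ_q + Ψ_q`)
to the finite-dimensional obligation `TopEig.TopBotEigSplitting q c` with a share `c > 0`:
`M ≥ 0` and a convex `1`-Lipschitz `h ≥ 0` on flat tensors with
`λ(A)^q + λ(−A)^q = M·h(A)^q + c·‖A‖^q` for every symmetric trace-free `A` (`λ = TopEig.lam`, the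
top Rayleigh value of the tree; `λ(S) = λ₁`, `λ(−S) = −λ₃` on a strain). K10 PROVES
`∃ c > 0, TopBotEigSplitting q c` for EVERY REAL `q ≥ 2` (K10c
`TopEig.topBotEigSplitting_exists`, the obligation written out word for word), by an elementary
SECOND-DIFFERENCE argument that uses no eigenvalue calculus beyond `λ`: no Lewis–Sendov / Davis
spectral-function theory, no smoothness of eigenvalues, no majorisation.

WHAT IS PROVED HERE [ours / folklore]:
* §4 `TopEig.abs_rpow_sub_rpow_le_of_mem_Icc` (Lipschitz bound of `s ↦ s^r`, `r ≥ 0`, on `[lo, hi]`,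
  `lo > 0`, mean value theorem), the constant `ceilC q > 0` and the **SECOND-DIFFERENCE CEILING**
  `TopEig.normDensity_secondDiff_le (hq : 2 ≤ q) (hB0 : B ≠ 0) (hXB : 2‖X‖ ≤ ‖B‖) :
  N(B+X) + N(B−X) − 2N(B) ≤ ceilC q·(‖B‖²)^{q/2−1}·‖X‖²`, `N = (‖·‖²)^{q/2}` (tangent lines of
  `s ↦ s^{q/2}` at `‖B±X‖²` and at `‖B‖² + ‖X‖²`, parallelogram law, Cauchy–Schwarz, §4 Lipschitz).
* §5 the constants `floorC q`, **`shareConst q = min(floorC q/ceilC q, 2(1/36)^{q/2}) > 0`**, the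
  SPLIT DENSITY `splitDensity q c = coreDensity q − c·normDensity q` (even, `q`-homogeneous,
  continuous, `= 0` at `0`), `splitDensity_nonneg` on symmetric trace-free tensors for
  `c ≤ shareConst q`, and **`TopEig.splitDensity_secondDiff_nonneg`**: `2k(B) ≤ k(B+X) + k(B−X)` for
  `q ≥ 2`, `0 ≤ c ≤ shareConst q`, symmetric trace-free `B ≠ 0`, `X`, `2‖X‖ ≤ ‖B‖` (K10a floor
  against the §4 ceiling).
* §6 `TopEig.nonpos_of_local_midpoint` / **`TopEig.convexOn_univ_of_local_midpoint`**: a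
  continuous `φ : ℝ → ℝ` with `2φ(m) ≤ φ(m−δ) + φ(m+δ)` for all `0 < δ ≤ δ₀(m)`, every `m`, is convex
  (smallest maximiser of `φ −` chord on a compact interval; no uniform step, no dyadics), and
  `TopEig.convexOn_univ_of_lines` (convexity on flat tensors from convexity along lines).

WHAT IS NOT PROVED HERE. The convexity of `k ∘ π` and the gauge: K10c. `shareConst` is far from the
optimal share (census-2's float screen (dd.223) suggests the threshold `6^{−q/2}(2^q + 1 − F₊(q))`,
`= 1/3` at `q = 2`); only `shareConst q > 0` is used downstream.

PROVENANCE / STATUS. Typed and farm-checked by the no-go seat (gen 38): K10a stand-alone, K10b and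
K10c as concatenations with their imports (evidence `pub-nsfunc-nogo/sieveld/ktg/`, incl. the
K9∘K10 JOINT check `TopBotEigHeatCoercivePos q` for every real `q > 2` and the value
`shareConst 4 = 1/999`); STATUS: STAGED (`pub-nsfunc-nogo/NoGo/<name>.STAGING.lean`), filing by a
prove seat on the lead's word, in the order K10a → K10b → K10c, after K7/K8/K9 (the planner seat
cannot file under `FunctionalMining/`). Search for candidate a priori estimates; no regularity
claim. [ours; K1-Q6 (c) = door D-K6 (c), finite-dimensional side, `q ≥ 2`]
FILING (prove seat g26, REQUEST #24b): declarations byte-identical to the no-go seat's staged `TopBotEigSplitCeiling.STAGING.lean` 96f693dcb1dea072; this FILING line plus 9 one-line docstrings added for the gate's lint.docstring (ceilC_pos, floorC_pos, shareConst_pos/_le_div/_le_two_mul, splitDensity_neg/_smul/_zero, continuous_splitDensity); declarations themselves byte-identical; these are the only changes.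
-/

noncomputable section

open Finset Set Real

namespace Summit.NavierStokesRegularity.FunctionalMining

namespace TopEig

/-! ## 4. The second-difference CEILING of the norm density (steps `‖X‖ ≤ ‖B‖/2`) -/

/-- Lipschitz bound for `s ↦ s^r` (`r ≥ 0`) on `[lo, hi]`, `lo > 0`:
`|x^r − y^r| ≤ r·(lo^{r−1} + hi^{r−1})·|x − y|`. [folklore; mean value theorem] -/
theorem abs_rpow_sub_rpow_le_of_mem_Icc {lo hi r x y : ℝ} (hlo : 0 < lo) (hr : 0 ≤ r) (hx : x ∈ Icc lo hi)
    (hy : y ∈ Icc lo hi) : |x ^ r - y ^ r| ≤ r * (lo ^ (r - 1) + hi ^ (r - 1)) * |x - y| := by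
  have hdiff : ∀ s ∈ Icc lo hi, DifferentiableAt ℝ (fun s : ℝ => s ^ r) s := fun s hs =>
    (Real.hasDerivAt_rpow_const (Or.inl (hlo.trans_le hs.1).ne')).differentiableAt
  have hbd : ∀ s ∈ Icc lo hi, ‖deriv (fun s : ℝ => s ^ r) s‖ ≤ r * (lo ^ (r - 1) + hi ^ (r - 1)) := by
    intro s hs
    have hs0 : 0 < s := hlo.trans_le hs.1
    rw [Real.deriv_rpow_const, Real.norm_of_nonneg (mul_nonneg hr (Real.rpow_nonneg hs0.le _))]
    refine mul_le_mul_of_nonneg_left ?_ hr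
    have hlo' : 0 ≤ lo ^ (r - 1) := Real.rpow_nonneg hlo.le _
    have hhi' : 0 ≤ hi ^ (r - 1) := Real.rpow_nonneg (hlo.le.trans (hs.1.trans hs.2)) _
    rcases le_or_gt 0 (r - 1) with h1 | h1
    · have := Real.rpow_le_rpow hs0.le hs.2 h1; linarith
    · have := Real.rpow_le_rpow_of_nonpos hlo hs.1 h1.le; linarith
  have h := (convex_Icc lo hi).norm_image_sub_le_of_norm_deriv_le hdiff hbd hy hx
  simpa only [Real.norm_eq_abs] using h

/-- The ceiling constant `C_N(q) = 8p(p−1)·((1/4)^{p−2} + (9/4)^{p−2}) + 2p·(5/4)^{p−1}`, `p = q/2`.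
[ours] -/
def ceilC (q : ℝ) : ℝ :=
  8 * (q / 2) * (q / 2 - 1) * ((1 / 4 : ℝ) ^ (q / 2 - 2) + (9 / 4 : ℝ) ^ (q / 2 - 2)) +
    2 * (q / 2) * (5 / 4 : ℝ) ^ (q / 2 - 1)

/-- `C_N(q) > 0` for `q ≥ 2`. [bookkeeping] -/
theorem ceilC_pos {q : ℝ} (hq : 2 ≤ q) : 0 < ceilC q := by
  unfold ceilC
  have h1 : 0 ≤ 8 * (q / 2) * (q / 2 - 1) * ((1 / 4 : ℝ) ^ (q / 2 - 2) + (9 / 4 : ℝ) ^ (q / 2 - 2)) :=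
    mul_nonneg (mul_nonneg (by linarith) (by linarith)) (by positivity)
  have h2 : 0 < 2 * (q / 2) * (5 / 4 : ℝ) ^ (q / 2 - 1) := by
    have : 0 < (5 / 4 : ℝ) ^ (q / 2 - 1) := Real.rpow_pos_of_pos (by norm_num) _
    nlinarith
  linarith

/-- **SECOND-DIFFERENCE CEILING of the norm density** `N = (‖·‖²)^{q/2}`, `q ≥ 2`, for steps
`‖X‖ ≤ ‖B‖/2`: `N(B+X) + N(B−X) − 2N(B) ≤ C_N(q)·(‖B‖²)^{q/2−1}·‖X‖²` (tangent lines of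
`s ↦ s^{q/2}` at `‖B±X‖²` and at `‖B‖² + ‖X‖²`, the parallelogram law, Cauchy–Schwarz, and the
Lipschitz bound for `s ↦ s^{q/2−1}` on `[‖B‖²/4, 9‖B‖²/4]`). [ours] -/
theorem normDensity_secondDiff_le {q : ℝ} (hq : 2 ≤ q) {B X : Tens3} (hB0 : B ≠ 0)
    (hXB : 2 * ‖X‖ ≤ ‖B‖) :
    normDensity q (B + X) + normDensity q (B - X) - 2 * normDensity q B ≤
      ceilC q * (‖B‖ ^ 2) ^ (q / 2 - 1) * ‖X‖ ^ 2 := by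
  unfold normDensity ceilC
  set p : ℝ := q / 2 with hpdef
  have hp1 : 1 ≤ p := by rw [hpdef]; linarith
  have hBn : 0 < ‖B‖ := norm_pos_iff.mpr hB0
  set m : ℝ := ‖B‖ ^ 2 with hmdef
  have hm : 0 < m := by positivity
  set a : ℝ := ‖B + X‖ ^ 2 with hadef
  set b : ℝ := ‖B - X‖ ^ 2 with hbdef
  have hX0 : 0 ≤ ‖X‖ := norm_nonneg X
  -- parallelogram law and Cauchy–Schwarz
  have hab : a + b = 2 * (m + ‖X‖ ^ 2) := parallelogram_law_with_norm ℝ B X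
  have hdiff : a - b = 4 * inner ℝ B X := by
    simp only [hadef, hbdef]; rw [norm_add_sq_real, norm_sub_sq_real]; ring
  have hCS : (a - b) ^ 2 ≤ 16 * m * ‖X‖ ^ 2 := by
    have h' : (inner ℝ B X) ^ 2 ≤ (‖B‖ * ‖X‖) ^ 2 := by
      rw [← sq_abs (inner ℝ B X)]
      exact pow_le_pow_left₀ (abs_nonneg _) (abs_real_inner_le_norm B X) 2
    rw [hdiff, hmdef]; linarith [h']
  -- ranges of a, b : [m/4, 9m/4]
  have h3p : ‖B‖ ≤ ‖B + X‖ + ‖X‖ := by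
    have := norm_add_le (B + X) (-X); rwa [add_neg_cancel_right, norm_neg] at this
  have h3m : ‖B‖ ≤ ‖B - X‖ + ‖X‖ := by
    have := norm_add_le (B - X) X; rwa [sub_add_cancel] at this
  have hpl : ‖B‖ / 2 ≤ ‖B + X‖ := by linarith
  have hpu : ‖B + X‖ ≤ 3 / 2 * ‖B‖ := by have := norm_add_le B X; linarith
  have hml : ‖B‖ / 2 ≤ ‖B - X‖ := by linarith
  have hmu : ‖B - X‖ ≤ 3 / 2 * ‖B‖ := by have := norm_sub_le B X; linarith
  have hB2 : 0 ≤ ‖B‖ / 2 := by linarith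
  have ha : a ∈ Icc (m / 4) (9 * m / 4) := by
    rw [Set.mem_Icc, hadef, hmdef]
    have l := pow_le_pow_left₀ hB2 hpl 2
    have u := pow_le_pow_left₀ (norm_nonneg _) hpu 2
    constructor <;> linarith
  have hb : b ∈ Icc (m / 4) (9 * m / 4) := by
    rw [Set.mem_Icc, hbdef, hmdef]
    have l := pow_le_pow_left₀ hB2 hml 2
    have u := pow_le_pow_left₀ (norm_nonneg _) hmu 2
    constructor <;> linarith
  have ha0 : 0 ≤ a := by positivity
  have hb0 : 0 ≤ b := by positivity
  have hc00 : 0 ≤ m + ‖X‖ ^ 2 := by positivity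
  -- (i) drift of the midpoint: (m + ‖X‖²)^p − m^p ≤ p (5/4)^{p−1} m^{p−1} ‖X‖²
  have t0 := rpow_tangent_le hc00 hm.le hp1
  have hc0le : (m + ‖X‖ ^ 2) ^ (p - 1) ≤ (5 / 4 : ℝ) ^ (p - 1) * m ^ (p - 1) := by
    rw [← Real.mul_rpow (by norm_num) hm.le]
    refine Real.rpow_le_rpow hc00 ?_ (by linarith)
    have : ‖X‖ ^ 2 ≤ (‖B‖ / 2) ^ 2 := pow_le_pow_left₀ hX0 (by linarith) 2
    rw [hmdef]; linarith
  have hi : (m + ‖X‖ ^ 2) ^ p - m ^ p ≤ p * ((5 / 4 : ℝ) ^ (p - 1) * m ^ (p - 1)) * ‖X‖ ^ 2 := by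
    have e : m - (m + ‖X‖ ^ 2) = -‖X‖ ^ 2 := by ring
    rw [e] at t0
    have : p * (m + ‖X‖ ^ 2) ^ (p - 1) * ‖X‖ ^ 2 ≤
        p * ((5 / 4 : ℝ) ^ (p - 1) * m ^ (p - 1)) * ‖X‖ ^ 2 :=
      mul_le_mul_of_nonneg_right (mul_le_mul_of_nonneg_left hc0le (by linarith)) (sq_nonneg _)
    linarith
  -- (ii) spread: a^p + b^p − 2(m + ‖X‖²)^p ≤ (p/2)(a^{p−1} − b^{p−1})(a − b)
  have ta := rpow_tangent_le ha0 hc00 hp1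
  have tb := rpow_tangent_le hb0 hc00 hp1
  have hii : a ^ p + b ^ p - 2 * (m + ‖X‖ ^ 2) ^ p ≤
      p / 2 * ((a ^ (p - 1) - b ^ (p - 1)) * (a - b)) := by
    have e1 : m + ‖X‖ ^ 2 - a = (b - a) / 2 := by linarith
    have e2 : m + ‖X‖ ^ 2 - b = (a - b) / 2 := by linarith
    rw [e1] at ta; rw [e2] at tb
    linarith [ta, tb]
  -- (iii) Lipschitz bound for s ↦ s^{p−1} on [m/4, 9m/4]
  have hL := abs_rpow_sub_rpow_le_of_mem_Icc (r := p - 1) (by positivity : 0 < m / 4) (by linarith) ha hb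
  have hQ : (m / 4) ^ (p - 1 - 1) + (9 * m / 4) ^ (p - 1 - 1) =
      ((1 / 4 : ℝ) ^ (p - 2) + (9 / 4 : ℝ) ^ (p - 2)) * m ^ (p - 2) := by
    rw [show p - 1 - 1 = p - 2 by ring, show m / 4 = (1 / 4 : ℝ) * m by ring,
      show 9 * m / 4 = (9 / 4 : ℝ) * m by ring, Real.mul_rpow (by norm_num) hm.le,
      Real.mul_rpow (by norm_num) hm.le]
    ring
  rw [hQ] at hL
  have hQ0 : 0 ≤ (1 / 4 : ℝ) ^ (p - 2) + (9 / 4 : ℝ) ^ (p - 2) := by positivity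
  have hmm : m ^ (p - 2) * m = m ^ (p - 1) := by
    have : m ^ (p - 1) = m ^ (p - 2 + 1) := by congr 1; ring
    rw [this, Real.rpow_add hm, Real.rpow_one]
  set Q : ℝ := (1 / 4 : ℝ) ^ (p - 2) + (9 / 4 : ℝ) ^ (p - 2) with hQdef
  have hiii : (a ^ (p - 1) - b ^ (p - 1)) * (a - b) ≤
      (p - 1) * (Q * m ^ (p - 2)) * (16 * m * ‖X‖ ^ 2) := by
    have h1 : (a ^ (p - 1) - b ^ (p - 1)) * (a - b) ≤ |a ^ (p - 1) - b ^ (p - 1)| * |a - b| := by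
      rw [← abs_mul]; exact le_abs_self _
    have hK : 0 ≤ (p - 1) * (Q * m ^ (p - 2)) :=
      mul_nonneg (by linarith) (mul_nonneg hQ0 (Real.rpow_nonneg hm.le _))
    have h2 : |a ^ (p - 1) - b ^ (p - 1)| * |a - b| ≤
        (p - 1) * (Q * m ^ (p - 2)) * |a - b| * |a - b| :=
      mul_le_mul_of_nonneg_right hL (abs_nonneg _)
    have h3 : |a - b| * |a - b| ≤ 16 * m * ‖X‖ ^ 2 := by rw [← sq, sq_abs]; exact hCS
    calc (a ^ (p - 1) - b ^ (p - 1)) * (a - b) ≤ _ := h1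
      _ ≤ _ := h2
      _ = (p - 1) * (Q * m ^ (p - 2)) * (|a - b| * |a - b|) := by ring
      _ ≤ _ := mul_le_mul_of_nonneg_left h3 hK
  -- assemble
  have h4 : p / 2 * ((a ^ (p - 1) - b ^ (p - 1)) * (a - b)) ≤
      p / 2 * ((p - 1) * (Q * m ^ (p - 2)) * (16 * m * ‖X‖ ^ 2)) :=
    mul_le_mul_of_nonneg_left hiii (by linarith)
  have e : p / 2 * ((p - 1) * (Q * m ^ (p - 2)) * (16 * m * ‖X‖ ^ 2)) =
      8 * p * (p - 1) * Q * (m ^ (p - 2) * m) * ‖X‖ ^ 2 := by ring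
  rw [e, hmm] at h4
  have hgoal : a ^ p + b ^ p - 2 * m ^ p ≤
      (8 * p * (p - 1) * Q + 2 * p * (5 / 4 : ℝ) ^ (p - 1)) * m ^ (p - 1) * ‖X‖ ^ 2 := by
    linarith [h4, hii, hi]
  linarith [hgoal]

/-! ## 5. The split density `k = f_q − c·‖·‖^q`: non-negativity and non-negative second
differences for small steps, for every share `0 ≤ c ≤ c(q)` -/

/-- The floor constant `(q/3)·(1/36)^{q/2−1}` of §3. [ours] -/
def floorC (q : ℝ) : ℝ := q / 3 * (1 / 36 : ℝ) ^ (q / 2 - 1)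

/-- `floorC q > 0` for `q ≥ 2`. [bookkeeping] -/
theorem floorC_pos {q : ℝ} (hq : 2 ≤ q) : 0 < floorC q :=
  mul_pos (by linarith) (Real.rpow_pos_of_pos (by norm_num) _)

/-- The SHARE CONSTANT `c(q) = min( floorC(q)/ceilC(q), 2·(1/36)^{q/2} ) > 0`. [ours] -/
def shareConst (q : ℝ) : ℝ := min (floorC q / ceilC q) (2 * (1 / 36 : ℝ) ^ (q / 2))

/-- `c(q) > 0` for `q ≥ 2`. [bookkeeping] -/
theorem shareConst_pos {q : ℝ} (hq : 2 ≤ q) : 0 < shareConst q :=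
  lt_min (div_pos (floorC_pos hq) (ceilC_pos hq))
    (mul_pos two_pos (Real.rpow_pos_of_pos (by norm_num) _))

/-- `c(q) ≤ floorC q / ceilC q`. [bookkeeping] -/
theorem shareConst_le_div {q : ℝ} : shareConst q ≤ floorC q / ceilC q := min_le_left _ _

/-- `c(q) ≤ 2·(1/36)^{q/2}`. [bookkeeping] -/
theorem shareConst_le_two_mul {q : ℝ} : shareConst q ≤ 2 * (1 / 36 : ℝ) ^ (q / 2) := min_le_right _ _

/-- The SPLIT DENSITY `k_{q,c} = f_q − c·(‖·‖²)^{q/2}`. [ours] -/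
def splitDensity (q c : ℝ) (A : Tens3) : ℝ := coreDensity q A - c * normDensity q A

/-- `k_{q,c}` is even. [bookkeeping] -/
theorem splitDensity_neg (q c : ℝ) (A : Tens3) : splitDensity q c (-A) = splitDensity q c A := by
  rw [splitDensity, splitDensity, coreDensity_neg, normDensity_neg]

/-- `k_{q,c}` is positively `q`-homogeneous. [bookkeeping] -/
theorem splitDensity_smul (q c : ℝ) {t : ℝ} (ht : 0 ≤ t) (A : Tens3) :
    splitDensity q c (t • A) = t ^ q * splitDensity q c A := by
  rw [splitDensity, splitDensity, coreDensity_smul q ht, normDensity_smul q ht]; ring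

/-- `k_{q,c}(0) = 0` (`q > 0`). [bookkeeping] -/
theorem splitDensity_zero {q : ℝ} (hq : 0 < q) (c : ℝ) : splitDensity q c 0 = 0 := by
  have h := splitDensity_smul q c le_rfl (0 : Tens3)
  rwa [zero_smul, Real.zero_rpow hq.ne', zero_mul] at h

/-- `k_{q,c}` is continuous (`q > 0`). [bookkeeping] -/
theorem continuous_splitDensity {q : ℝ} (hq : 0 < q) (c : ℝ) : Continuous (splitDensity q c) :=
  (continuous_coreDensity hq).sub (continuous_const.mul (continuous_normDensity hq))

/-- `k_{q,c} ≥ 0` on symmetric trace-free tensors for `0 ≤ c ≤ c(q)`. [ours] -/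
theorem splitDensity_nonneg {q c : ℝ} (hq : 2 ≤ q) (hc : c ≤ shareConst q) {A : Tens3}
    (hA : IsSymTF A) : 0 ≤ splitDensity q c A := by
  have hf := two_mul_rpow_le_coreDensity (by linarith : 0 < q) hA
  rw [show ‖A‖ ^ 2 / 36 = (1 / 36 : ℝ) * ‖A‖ ^ 2 by ring,
    Real.mul_rpow (by norm_num) (sq_nonneg _)] at hf
  have hc' := hc.trans shareConst_le_two_mul
  have hN : 0 ≤ normDensity q A := normDensity_nonneg q A
  unfold splitDensity
  unfold normDensity at hN ⊢
  nlinarith [mul_le_mul_of_nonneg_right hc' hN]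

/-- **NON-NEGATIVE SECOND DIFFERENCES of `k_{q,c}` for small steps**: for `q ≥ 2`,
`0 ≤ c ≤ c(q)`, symmetric trace-free `B ≠ 0` and `X` with `‖X‖ ≤ ‖B‖/2`,
`2k(B) ≤ k(B+X) + k(B−X)` (§3 floor against §4 ceiling). [ours] -/
theorem splitDensity_secondDiff_nonneg {q c : ℝ} (hq : 2 ≤ q) (hc0 : 0 ≤ c)
    (hc : c ≤ shareConst q) {B X : Tens3} (hB : IsSymTF B) (hX : IsSymTF X) (hB0 : B ≠ 0)
    (hXB : 2 * ‖X‖ ≤ ‖B‖) :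
    2 * splitDensity q c B ≤ splitDensity q c (B + X) + splitDensity q c (B - X) := by
  have hF := coreDensity_secondDiff_ge hq hB hX
  have hN := normDensity_secondDiff_le hq hB0 hXB
  have hP : 0 ≤ (‖B‖ ^ 2) ^ (q / 2 - 1) * ‖X‖ ^ 2 :=
    mul_nonneg (Real.rpow_nonneg (sq_nonneg _) _) (sq_nonneg _)
  rw [show ‖B‖ ^ 2 / 36 = (1 / 36 : ℝ) * ‖B‖ ^ 2 by ring,
    Real.mul_rpow (by norm_num) (sq_nonneg _)] at hF
  have hCp := ceilC_pos hq
  have hc' : c * ceilC q ≤ floorC q := by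
    have := hc.trans shareConst_le_div
    rwa [le_div_iff₀ hCp] at this
  have h1 : c * (normDensity q (B + X) + normDensity q (B - X) - 2 * normDensity q B) ≤
      c * (ceilC q * (‖B‖ ^ 2) ^ (q / 2 - 1) * ‖X‖ ^ 2) := mul_le_mul_of_nonneg_left hN hc0
  have h2 : c * (ceilC q * (‖B‖ ^ 2) ^ (q / 2 - 1) * ‖X‖ ^ 2) ≤
      floorC q * ((‖B‖ ^ 2) ^ (q / 2 - 1) * ‖X‖ ^ 2) := by
    rw [show c * (ceilC q * (‖B‖ ^ 2) ^ (q / 2 - 1) * ‖X‖ ^ 2) =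
      (c * ceilC q) * ((‖B‖ ^ 2) ^ (q / 2 - 1) * ‖X‖ ^ 2) by ring]
    exact mul_le_mul_of_nonneg_right hc' hP
  have h3 : floorC q * ((‖B‖ ^ 2) ^ (q / 2 - 1) * ‖X‖ ^ 2) =
      q / 3 * ((1 / 36 : ℝ) ^ (q / 2 - 1) * (‖B‖ ^ 2) ^ (q / 2 - 1)) * ‖X‖ ^ 2 := by
    unfold floorC; ring
  unfold splitDensity
  linarith [hF, h1, h2, h3]

/-! ## 6. One-dimensional convexity from LOCAL midpoint second differences (smallest-maximiser
argument; no uniform step size and no dyadic iteration are needed) -/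

/-- A continuous `g : ℝ → ℝ` with non-negative second differences for all sufficiently small
steps at every point, and `g ≤ 0` at the ends of `[x, y]`, is `≤ 0` on `[x, y]`. [folklore] -/
theorem nonpos_of_local_midpoint {g : ℝ → ℝ} (hg : Continuous g)
    (h : ∀ m : ℝ, ∃ δ₀ : ℝ, 0 < δ₀ ∧ ∀ δ : ℝ, 0 < δ → δ ≤ δ₀ → 2 * g m ≤ g (m - δ) + g (m + δ))
    {x y : ℝ} (hxy : x ≤ y) (hx : g x ≤ 0) (hy : g y ≤ 0) : ∀ t ∈ Icc x y, g t ≤ 0 := by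
  by_contra! hcon
  obtain ⟨t₀, ht₀, hgt₀⟩ := hcon
  obtain ⟨m₁, hm₁, hmax⟩ :=
    (isCompact_Icc (a := x) (b := y)).exists_isMaxOn (nonempty_Icc.2 hxy) hg.continuousOn
  set M : ℝ := g m₁ with hMdef
  have hMpos : 0 < M := hgt₀.trans_le (hmax ht₀)
  set S : Set ℝ := Icc x y ∩ {t | M ≤ g t} with hSdef
  have hSclosed : IsClosed S := isClosed_Icc.inter (isClosed_le continuous_const hg)
  have hSne : S.Nonempty := ⟨m₁, hm₁, by show M ≤ g m₁; rw [hMdef]⟩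
  have hSbdd : BddBelow S := ⟨x, fun t ht => ht.1.1⟩
  have hmS : sInf S ∈ S := hSclosed.csInf_mem hSne hSbdd
  set m : ℝ := sInf S with hmdef
  have hgm : g m = M := le_antisymm (hmax hmS.1) hmS.2
  have hxm : x < m := lt_of_le_of_ne hmS.1.1 (fun e => by rw [← e] at hgm; linarith)
  have hmy : m < y := lt_of_le_of_ne hmS.1.2 (fun e => by rw [e] at hgm; linarith)
  obtain ⟨δ₀, hδ₀, hδ⟩ := h m
  set δ : ℝ := min δ₀ (min (m - x) (y - m)) with hδdef
  have hδpos : 0 < δ := lt_min hδ₀ (lt_min (by linarith) (by linarith))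
  have hδ₀' : δ ≤ δ₀ := min_le_left _ _
  have hδ1 : δ ≤ m - x := (min_le_right _ _).trans (min_le_left _ _)
  have hδ2 : δ ≤ y - m := (min_le_right _ _).trans (min_le_right _ _)
  have h2 := hδ δ hδpos hδ₀'
  have hplus : g (m + δ) ≤ M := hmax ⟨by linarith, by linarith⟩
  have hminus : g (m - δ) < M := by
    by_contra! hc
    have hin : m - δ ∈ S := ⟨⟨by linarith, by linarith⟩, hc⟩
    have := csInf_le hSbdd hin
    linarith
  linarith

/-- **Lemma (M′).** A continuous `φ : ℝ → ℝ` with `2φ(m) ≤ φ(m−δ) + φ(m+δ)` for every `m` and all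
`0 < δ ≤ δ₀(m)` is convex. [folklore] -/
theorem convexOn_univ_of_local_midpoint {φ : ℝ → ℝ} (hφ : Continuous φ)
    (h : ∀ m : ℝ, ∃ δ₀ : ℝ, 0 < δ₀ ∧ ∀ δ : ℝ, 0 < δ → δ ≤ δ₀ → 2 * φ m ≤ φ (m - δ) + φ (m + δ)) :
    ConvexOn ℝ univ φ := by
  refine LinearOrder.convexOn_of_lt convex_univ fun x _ y _ hxy a b ha hb hab => ?_
  set s : ℝ := (φ y - φ x) / (y - x) with hsdef
  set g : ℝ → ℝ := fun t => φ t - (φ x + s * (t - x)) with hgdef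
  have hg : Continuous g := by
    simp only [hgdef]; fun_prop
  have hgx : g x ≤ 0 := by simp [hgdef]
  have hyx : y - x ≠ 0 := by linarith
  have hsyx : s * (y - x) = φ y - φ x := by rw [hsdef, div_mul_cancel₀ _ hyx]
  have hgy : g y ≤ 0 := by simp only [hgdef]; linarith
  have hloc : ∀ m : ℝ, ∃ δ₀ : ℝ, 0 < δ₀ ∧ ∀ δ : ℝ, 0 < δ → δ ≤ δ₀ →
      2 * g m ≤ g (m - δ) + g (m + δ) := by
    intro m
    obtain ⟨δ₀, hδ₀, hδ⟩ := h m
    refine ⟨δ₀, hδ₀, fun δ hd hd' => ?_⟩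
    have := hδ δ hd hd'
    simp only [hgdef]; linarith
  have hab' : a = 1 - b := by linarith
  have hbyx : 0 ≤ b * (y - x) := mul_nonneg hb.le (by linarith)
  have hayx : 0 ≤ (1 - b) * (y - x) := mul_nonneg (by linarith) (by linarith)
  have ht : a * x + b * y ∈ Icc x y := by
    rw [Set.mem_Icc, hab']; constructor <;> linarith
  have hle := nonpos_of_local_midpoint hg hloc hxy.le hgx hgy _ ht
  have e : s * (a * x + b * y - x) = b * (φ y - φ x) := by
    have : a * x + b * y - x = b * (y - x) := by rw [hab']; ring
    rw [this, show s * (b * (y - x)) = b * (s * (y - x)) by ring, hsyx]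
  have haφ : a * φ x = φ x - b * φ x := by rw [hab']; ring
  simp only [hgdef, smul_eq_mul] at hle ⊢
  linarith [hle, e, haφ]

/-- Convexity on `Tens3` from convexity along all lines. [folklore] -/
theorem convexOn_univ_of_lines {F : Tens3 → ℝ}
    (h : ∀ A Y : Tens3, ConvexOn ℝ univ (fun t : ℝ => F (A + t • Y))) : ConvexOn ℝ univ F := by
  refine ⟨convex_univ, fun A _ B _ a b ha hb hab => ?_⟩
  have hc := (h A (B - A)).2 (mem_univ (0 : ℝ)) (mem_univ (1 : ℝ)) ha hb hab
  simp only [zero_smul, add_zero, one_smul, smul_eq_mul, mul_zero, mul_one, zero_add,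
    add_sub_cancel] at hc
  have e : a • A + b • B = A + b • (B - A) := by
    rw [show a = 1 - b by linarith]; module
  rw [e]; exact hc

end TopEig

end Summit.NavierStokesRegularity.FunctionalMining
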